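import Literature.Analysis.FluidPDE.TypeIAncientMild
import Literature.Analysis.FluidPDE.KNSSLocalSmoothingHolds
import Literature.Analysis.FluidPDE.NSBoundedMildSmoothing
import HarnessLib

/-!
# Crux `FrequencyRigidity` (stmt-NavierStokesRegularity-2955), line `moving-adjoint-bernoulli`,
# stub `stub_mildFrameBounds` — helper: scale-invariant bounds of ALL orders (space and time)
# for Type-I ancient mild fields

Helper file (lands `--supports stmt-NavierStokesRegularity-2955`; theorems only). For every Type-I
constant `C` and all orders `k, l` there is `K = K(C, k, l, E)` such that every field `u` of the
class `IsTypeIAncientMild C u` (jointly smooth on `t < 0`, divergence free, KNSS-mild between all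
pairs of negative times at unit viscosity, `‖u(t, x)‖ ≤ C/√(−t)`) obeys

  `‖∇ᵏₓ ∂ₜˡ u(t, x)‖ ≤ K (−t)^{−(1 + k + 2l)/2}`   for all `t < 0`, `x`.

This is KNSS 2009, Prop. 4.1 (4.5)–(4.6) in scale-invariant form on the ancient Type-I class: at a
time `t < 0` restart the Oseen integral equation from the datum `u(s')`, `s' = t − h/2`, where
`h = ε/M²` is the life span of the quantitative local theory (the tree's PROVED fact
`knss2009_local_smoothing_holds`) for the bound `M = K₀/√(−t)`, `K₀ = C√2 + √ε + 1`, of `u` on the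
window `(s', t/2)`; bounded solutions of the integral equation are unique
(`exists_local_smooth_representative`, through `oseenMild_essBounded_unique`), so `u` IS the smooth
local solution near `t`, whose mixed derivatives at clock `t − s' = h/2 ∼ (−t)` are bounded by
`C_L M (t − s')^{−k/2−l} ∼ (−t)^{−(1+k+2l)/2}`. No rescaling of the class is needed: the local
theory is already scale covariant in form.

## References

* G. Koch, N. Nadirashvili, G. Seregin, V. Šverák, *Liouville theorems for the Navier–Stokes
  equations and applications*, Acta Math. 203 (2009) 83–105 = arXiv:0709.3599, §4 Prop. 4.1,
  (4.5)–(4.6), (4.10)–(4.11). [KochNadirashviliSereginSverak2009]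
-/

set_option linter.dupNamespace false

noncomputable section

namespace Summit.NavierStokesRegularity.NavierStokesRegularity.Theorems.FrequencyRigidity.MovingAdjointBernoulli

open Literature.Analysis Literature.Analysis.FluidPDE MeasureTheory Set Filter Topology Function
open scoped ENNReal

variable {E : Type*} [NormedAddCommGroup E] [InnerProductSpace ℝ E] [FiniteDimensional ℝ E]
  [MeasurableSpace E] [BorelSpace E]

/-- Arithmetic of the exponents: for `T > 0`, `a > 0`,
`T^{-1/2} · (a T)^{-(k/2)} · (a T)^{-l} = a^{-(k/2 + l)} · T^{-(1 + k + 2l)/2}`. [folklore] -/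
private theorem rpow_bookkeeping {T a : ℝ} (hT : 0 < T) (ha : 0 < a) (k l : ℕ) :
    (Real.sqrt T)⁻¹ * ((a * T) ^ ((k : ℝ) / 2))⁻¹ * ((a * T) ^ l)⁻¹ =
      a ^ (-((k : ℝ) / 2 + l)) * T ^ (-((1 : ℝ) + k + 2 * l) / 2) := by
  have haT : 0 < a * T := mul_pos ha hT
  rw [Real.sqrt_eq_rpow, ← Real.rpow_natCast (a * T) l, ← Real.rpow_neg hT.le,
    ← Real.rpow_neg haT.le, ← Real.rpow_neg haT.le, Real.mul_rpow ha.le hT.le,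
    Real.mul_rpow ha.le hT.le]
  have h1 : a ^ (-((k : ℝ) / 2 + l)) = a ^ (-((k : ℝ) / 2)) * a ^ (-(l : ℝ)) := by
    rw [← Real.rpow_add ha]; ring_nf
  have h2 : T ^ (-((1 : ℝ) + k + 2 * l) / 2) =
      T ^ (-(1 / 2 : ℝ)) * (T ^ (-((k : ℝ) / 2)) * T ^ (-(l : ℝ))) := by
    rw [← Real.rpow_add hT, ← Real.rpow_add hT]; ring_nf
  rw [h1, h2]; ring

/-- **Scale-invariant bounds of all orders for Type-I ancient mild fields** (KNSS 2009, Prop. 4.1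
in scale-invariant form). For every `C` and all `k, l` there is `K` such that every `u` with
`IsTypeIAncientMild C u` satisfies `‖∇ᵏₓ∂ₜˡu(t, x)‖ ≤ K (−t)^{−(1+k+2l)/2}` for all `t < 0` and
all `x` (`∇ᵏₓ∂ₜˡu(t,x) = iteratedFDeriv ℝ k (fun y => iteratedDeriv l (u · y) t) x`). Proof: the
quantitative local theory `knss2009_local_smoothing_holds` restarted from `u(t − h/2)`,
`h = ε(−t)/K₀²`, `K₀ = C√2 + √ε + 1`, and uniqueness of bounded solutions of the Oseen integral
equation (`exists_local_smooth_representative`).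
[cite: KochNadirashviliSereginSverak2009, §4 Prop. 4.1 (4.5)–(4.6) (arXiv:0709.3599 p. 8)] -/
private theorem typeIAncientMild_mixedDeriv_bound (C : ℝ) (k l : ℕ) :
    ∃ K : ℝ, 0 ≤ K ∧ ∀ (u : ℝ → E → E), IsTypeIAncientMild C u → ∀ t < 0, ∀ x : E,
      ‖iteratedFDeriv ℝ k (fun y => iteratedDeriv l (fun τ => u τ y) t) x‖ ≤
        K * (-t) ^ (-((1 : ℝ) + k + 2 * l) / 2) := by
  obtain ⟨ε, hε, CL, hCL, hL⟩ := knss2009_local_smoothing_holds E k l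
  -- the constants
  set K₀ : ℝ := max C 0 * Real.sqrt 2 + Real.sqrt ε + 1 with hK₀
  have hsε : 0 < Real.sqrt ε := Real.sqrt_pos.2 hε
  have hK₀pos : 0 < K₀ := by
    have : 0 ≤ max C 0 * Real.sqrt 2 := by positivity
    rw [hK₀]; linarith
  have hK₀ε : ε ≤ K₀ ^ 2 := by
    have h1 : Real.sqrt ε ≤ K₀ := by
      have : 0 ≤ max C 0 * Real.sqrt 2 := by positivity
      rw [hK₀]; linarith
    calc ε = Real.sqrt ε ^ 2 := (Real.sq_sqrt hε.le).symm
      _ ≤ K₀ ^ 2 := pow_le_pow_left₀ hsε.le h1 2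
  set a : ℝ := ε / (2 * K₀ ^ 2) with ha
  have hapos : 0 < a := by rw [ha]; positivity
  refine ⟨CL * K₀ * a ^ (-((k : ℝ) / 2 + l)), by positivity, fun u hu t ht x => ?_⟩
  have hC0 : 0 ≤ C := hu.nonneg
  have hCmax : max C 0 = C := max_eq_left hC0
  have hT : 0 < -t := neg_pos.2 ht
  have hst : 0 < Real.sqrt (-t) := Real.sqrt_pos.2 hT
  -- the bound `Mp = K₀ / √(−t)` on the window `(s', t/2)` and the life span `h = ε / Mp²`
  set Mp : ℝ := K₀ / Real.sqrt (-t) with hMp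
  have hMppos : 0 < Mp := div_pos hK₀pos hst
  set h : ℝ := ε * 1 / Mp ^ 2 with hh
  have hh' : h = 2 * (a * (-t)) := by
    rw [hh, hMp, div_pow, Real.sq_sqrt hT.le, ha]
    field_simp
  have hhle : h ≤ -t := by
    rw [hh, hMp, div_pow, Real.sq_sqrt hT.le, mul_one]
    rw [div_div_eq_mul_div]
    calc ε * -t / K₀ ^ 2 ≤ K₀ ^ 2 * -t / K₀ ^ 2 :=
          div_le_div_of_nonneg_right (mul_le_mul_of_nonneg_right hK₀ε hT.le) (by positivity)
      _ = -t := by field_simp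
  have hhpos : 0 < h := by rw [hh']; positivity
  set s' : ℝ := t - h / 2 with hs'
  set T₁ : ℝ := t / 2 with hT₁
  have hs't : s' < t := by rw [hs']; linarith
  have htT₁ : t < T₁ := by rw [hT₁]; linarith
  have hT₁0 : T₁ < 0 := by rw [hT₁]; linarith
  have hs'0 : s' < 0 := hs't.trans ht
  have hts'h : t - s' = h / 2 := by rw [hs']; ring
  -- the Type-I bound dominates: `C/√(−τ) ≤ Mp` for `τ < T₁ = t/2`
  have hbound : ∀ τ < T₁, ∀ y, ‖u τ y‖ ≤ Mp := by
    intro τ hτ y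
    have hτ0 : τ < 0 := hτ.trans hT₁0
    have h1 := hu.norm_le hτ0 y
    have h2 : C / Real.sqrt (-τ) ≤ C / Real.sqrt (-T₁) :=
      div_le_div_of_nonneg_left hC0 (Real.sqrt_pos.2 (neg_pos.2 hT₁0))
        (Real.sqrt_le_sqrt (by linarith))
    have h3 : C / Real.sqrt (-T₁) = C * Real.sqrt 2 / Real.sqrt (-t) := by
      have hs2 : 0 < Real.sqrt 2 := Real.sqrt_pos.2 (by norm_num)
      have : Real.sqrt (-t) = Real.sqrt 2 * Real.sqrt (-T₁) := by
        rw [← Real.sqrt_mul (by norm_num : (0:ℝ) ≤ 2)]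
        congr 1
        rw [hT₁]; ring
      rw [this]
      field_simp
    have h4 : C * Real.sqrt 2 / Real.sqrt (-t) ≤ Mp := by
      rw [hMp]
      refine div_le_div_of_nonneg_right ?_ hst.le
      rw [hK₀, hCmax]
      linarith [hsε.le]
    linarith
  have hbound_enn : ∀ τ < T₁, eLpNorm (u τ) ∞ volume ≤ ENNReal.ofReal Mp := by
    intro τ hτ
    rw [eLpNorm_exponent_top]
    exact eLpNormEssSup_le_of_ae_bound (Eventually.of_forall fun y => hbound τ hτ y)
  -- hypotheses of the local representative lemma
  have ha'm : AEStronglyMeasurable (u s') volume := hu.aestronglyMeasurable_slice hs'0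
  have ha'M : eLpNorm (u s') ∞ volume ≤ ENNReal.ofReal Mp := hbound_enn s' (hs't.trans htT₁)
  have hum : AEStronglyMeasurable (uncurry u)
      ((volume : Measure (ℝ × E)).restrict (Ioo s' T₁ ×ˢ univ)) :=
    hu.aestronglyMeasurable_uncurry hT₁0.le
  have huM : ∀ τ ∈ Ioo s' T₁, eLpNorm (u τ) ∞ volume ≤ ENNReal.ofReal Mp :=
    fun τ hτ => hbound_enn τ hτ.2
  have husol : ∀ τ ∈ Ioo s' T₁, u τ =ᵐ[volume] fun y =>
      UnboundedOperators.heatExtension (u s') (1 * (τ - s')) y - oseenDuhamel 1 s' u u τ y := by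
    intro τ hτ
    refine Eventually.of_forall fun y => ?_
    rw [one_mul]
    exact hu.mild_eq_heatExtension hτ.1 (hτ.2.trans hT₁0) y
  obtain ⟨v, -, -, hrepr, -, hvbd⟩ :=
    exists_local_smooth_representative (k := k) (l := l) (ε := ε) (C := CL) (T₁ := T₁) hL
      one_pos hMppos hCL ha'm ha'M hum huM husol
  -- `u = v` pointwise on the open time set `J = (s', min (s' + h) T₁) ∋ t`
  set J : Set ℝ := Ioo s' (min (s' + ε * 1 / Mp ^ 2) T₁) with hJ
  have htJ : t ∈ J := by
    refine ⟨hs't, lt_min ?_ htT₁⟩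
    rw [← hh, hs']; linarith
  have huv : ∀ τ ∈ J, ∀ y, u τ y = v τ y := by
    intro τ hτ y
    have hτT₁ : τ < T₁ := lt_of_lt_of_le hτ.2 (min_le_right _ _)
    rw [← hrepr τ hτ y, one_mul]
    exact hu.mild_eq_heatExtension hτ.1 (hτT₁.trans hT₁0) y
  have hcongr := iteratedFDeriv_iteratedDeriv_congr isOpen_Ioo htJ huv k l x
  rw [hcongr]
  -- the local bound at clock `t − s' = h/2 = a (−t)`
  have htI : t ∈ Ioo s' (s' + ε * 1 / Mp ^ 2) := by
    refine ⟨hs't, ?_⟩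
    rw [← hh, hs']; linarith
  have key := hvbd t htI x
  rw [one_mul, hts'h] at key
  have hclock : h / 2 = a * (-t) := by rw [hh']; ring
  rw [hclock] at key
  have haT : 0 < a * (-t) := mul_pos hapos hT
  have hp1 : 0 < (a * (-t)) ^ ((k : ℝ) / 2) := Real.rpow_pos_of_pos haT _
  have hp2 : 0 < (a * (-t)) ^ l := pow_pos haT l
  -- divide through
  set D : ℝ := ‖iteratedFDeriv ℝ k (fun y => iteratedDeriv l (fun τ => v τ y) t) x‖ with hD
  have hD0 : 0 ≤ D := norm_nonneg _
  have key' : D ≤ CL * Mp * (((a * (-t)) ^ ((k : ℝ) / 2))⁻¹ * ((a * (-t)) ^ l)⁻¹) := by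
    rw [← mul_inv, ← div_eq_mul_inv, le_div_iff₀ (mul_pos hp1 hp2)]
    calc D * ((a * (-t)) ^ ((k : ℝ) / 2) * (a * (-t)) ^ l)
        = (a * (-t)) ^ ((k : ℝ) / 2) * (a * (-t)) ^ l * D := by ring
      _ ≤ CL * Mp := key
  calc D ≤ CL * Mp * (((a * (-t)) ^ ((k : ℝ) / 2))⁻¹ * ((a * (-t)) ^ l)⁻¹) := key'
    _ = CL * K₀ * ((Real.sqrt (-t))⁻¹ * ((a * (-t)) ^ ((k : ℝ) / 2))⁻¹ * ((a * (-t)) ^ l)⁻¹) := by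
        rw [hMp]; ring
    _ = CL * K₀ * a ^ (-((k : ℝ) / 2 + l)) * (-t) ^ (-((1 : ℝ) + k + 2 * l) / 2) := by
        rw [rpow_bookkeeping hT hapos k l]; ring

/-- **Scale-invariant bounds of all orders for Type-I ancient mild fields on `ℝ³`** (KNSS 2009,
Prop. 4.1 in scale-invariant form; registered helper statement of stub `stub_mildFrameBounds`):
for every `C` and all `k, l` there is `K ≥ 0` such that every `u` with `IsTypeIAncientMild C u`
obeys `‖∇ᵏₓ∂ₜˡu(t, x)‖ ≤ K (−t)^{−(1+k+2l)/2}` for all `t < 0` and all `x`.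
[cite: KochNadirashviliSereginSverak2009, §4 Prop. 4.1 (4.5)–(4.6) (arXiv:0709.3599 p. 8)] -/
theorem mildFrame_typeIAncientMild_mixedDerivBound : ∀ (C : ℝ) (k l : ℕ), ∃ K : ℝ, 0 ≤ K ∧ ∀ (u : ℝ → EuclideanSpace ℝ (Fin 3) → EuclideanSpace ℝ (Fin 3)), Literature.Analysis.FluidPDE.IsTypeIAncientMild C u → ∀ t : ℝ, t < 0 → ∀ x : EuclideanSpace ℝ (Fin 3), ‖iteratedFDeriv ℝ k (fun y => iteratedDeriv l (fun τ => u τ y) t) x‖ ≤ K * (-t) ^ (-((1 : ℝ) + k + 2 * l) / 2) :=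
  fun C k l => typeIAncientMild_mixedDeriv_bound C k l

end Summit.NavierStokesRegularity.NavierStokesRegularity.Theorems.FrequencyRigidity.MovingAdjointBernoulli

end
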